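import Summits.BirchSwinnertonDyer.BirchSwinnertonDyer.Theorems.SmallImageMuTransferMuTransferX9StepOneDual
import Summits.BirchSwinnertonDyer.BirchSwinnertonDyer.Theorems.SmallImageMuTransferMuTransferX9StepOneSahOdd
import HarnessLib

/-!
# Step 1 of the `μ`-transfer core (`stub_coreX9`, crux 19276): both images on the joint kernel at
# EVERY ODD PRIME — the `p = 3` twin (class X10b = N2) of `…X9StepOneDual`

HOME/koly/MU-TRANSFER-PROOF.md §5 STEP 1 (joint form) on the GENUINE objects. The cell's
`LevelE.valueSubgroup_inf_eq_top_of_towerConst_ne_zero` / `…_of_shiftH1_iterate_ne_zero` (seat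
`bsd-smallim-k6-c2`, `…X9StepOneDual`) — the two "projects onto" hypotheses of the kernel schema
`theoremA_contradiction_schema` on ONE subgroup `N_{J+1}(κ) ⊓ N_{J'}(κ')` — carry `5 ≤ p` only
through the Sah input `exists_mem_inf_ker_apply_ne_zero`. With its odd-prime form
`exists_mem_inf_ker_apply_ne_zero_of_ne_two` (`…X9StepOneSahOdd`, cell `b2b-bsdres` x10 GEN 37: the
central homothety is `−1` at `p = 3` on class X10b∧¬Surj, koly p428450) the same two statements hold
for `p ≠ 2` — proofs verbatim. So the whole of STEP 1 is KERNEL on `{p odd} × {Irr, ¬Surj}` ⊇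
X9 ∪ X10b∧¬Surj, and ports to the N2 node `CoreTheoremAOnClassX10b` (x10 GEN 36) unchanged.
Nothing asserted, nothing booked; N2 stays CONSTRUCTION-SHAPED / NEEDS X_A3 (cell `b2b-bsdres`,
unit `b2b-bsdres-x10` = N2 class lead, GEN 37).

PARTITION (D-0054): X9 (A4) × p ∈ {5,7} and X10b (A5) × p = 3 — helper toward `stub_coreX9` /
`CoreTheoremAOnClassX10b`; closes none.
-/

set_option linter.dupNamespace false

noncomputable section

open Literature.NumberTheory.EllipticCurves Literature.NumberTheory.GaloisRepresentations Field
  Function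

namespace Summit.BirchSwinnertonDyer.BirchSwinnertonDyer.Rank1Residual.LevelE

variable (W : WeierstrassCurve ℚ) [W.IsElliptic] (p : ℕ) [Fact p.Prime] (κ κ' : ZpExtension ℚ p)

/-- **STEP 1 at every ODD prime, `h`-side on the joint kernel**:
`φ(N_{J+1}(κ) ⊓ N_{J'}(κ')) = 𝒯_{J+1}(E, κ)` for `φ` representing `κ'_{J+1}` with `κ̄' ≠ 0`
(`p ≠ 2`, `Irr`, `¬Surj` — class X9 at `p ∈ {5,7}`, class X10b∧¬Surj at `p = 3`). The `p ≠ 2` form of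
`valueSubgroup_inf_eq_top_of_towerConst_ne_zero`.
[cite: Serre1972, §2.4 Prop. 15 and §2.6] [cite: MazurRubin2004, §5.3] [cite: Sah1968, Prop. 2.7 (b)] -/
theorem valueSubgroup_inf_eq_top_of_towerConst_ne_zero_of_ne_two (hp2 : p ≠ 2)
    (hirr : W.HasIrreducibleModPGaloisRep p) (hns : ¬ W.HasSurjectiveModNGaloisRep p)
    {γ : absoluteGaloisGroup ℚ} (hγ : κ.IsTopGenerator γ)
    (y : κ.twistTower (W.torsionGaloisModule (p : ℤ))
      (fun P : WeierstrassCurve.geomTorsion W (p : ℤ) => AddSubgroup.torsionBy.nsmul P))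
    (hy : κ.towerConst (W.torsionGaloisModule (p : ℤ)) (fun P => AddSubgroup.torsionBy.nsmul P) y ≠ 0)
    (J J' : ℕ) (φ : contOneCocycles (W.modPTwist p κ (J + 1)).toTopRep)
    (hφ : oneCocycleClass (W.modPTwist p κ (J + 1)).toTopRep φ = y.1 (J + 1)) :
    contOneCocycles.valueSubgroup φ
      ((κ.twistModPRepresentation (W.torsionGaloisModule (p : ℤ))
          (fun P : WeierstrassCurve.geomTorsion W (p : ℤ) => AddSubgroup.torsionBy.nsmul P) (J + 1)).ker ⊓
        (κ'.twistModPRepresentation (W.torsionGaloisModule (p : ℤ))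
          (fun P : WeierstrassCurve.geomTorsion W (p : ℤ) => AddSubgroup.torsionBy.nsmul P) J').ker)
      (fun _ hτ x => κ.toTopRep_ρ_apply_eq_self_of_mem_ker (W.torsionGaloisModule (p : ℤ)) _ (J + 1)
        (Subgroup.mem_inf.mp hτ).1 x) = ⊤ :=
  valueSubgroup_eq_top_of_towerConst_ne_zero W p κ hirr hns hγ y hy J φ hφ _ _
    (fun ψ hψ => exists_mem_inf_ker_apply_ne_zero_of_ne_two W p κ κ' hp2 hirr hns (J + 1) J' ψ hψ)

/-- **STEP 1 at every ODD prime, `h^*`-side on the joint kernel**: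
`ψ(N_{J}(κ) ⊓ N_{J'+1}(κ')) = 𝒯_{J'+1}(E, κ')` for a cocycle `ψ` of the `κ'`-twist (e.g.
`κ' = κ.invTwist`, the dual deformation) whose class `c` has `T^{J'} c ≠ 0` (`p ≠ 2`, `Irr`,
`¬Surj`). The `p ≠ 2` form of `valueSubgroup_inf_eq_top_of_shiftH1_iterate_ne_zero`.
[cite: Serre1972, §2.4 Prop. 15 and §2.6] [cite: MazurRubin2004, §5.3] [cite: Sah1968, Prop. 2.7 (b)] -/
theorem valueSubgroup_inf_eq_top_of_shiftH1_iterate_ne_zero_of_ne_two (hp2 : p ≠ 2)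
    (hirr : W.HasIrreducibleModPGaloisRep p) (hns : ¬ W.HasSurjectiveModNGaloisRep p)
    {γ' : absoluteGaloisGroup ℚ} (hγ' : κ'.IsTopGenerator γ') (J J' : ℕ)
    (ψ : contOneCocycles (W.modPTwist p κ' (J' + 1)).toTopRep)
    (hψ : (κ'.shiftH1 (W.torsionGaloisModule (p : ℤ))
      (fun P : WeierstrassCurve.geomTorsion W (p : ℤ) => AddSubgroup.torsionBy.nsmul P) (J' + 1))^[J']
        (oneCocycleClass (W.modPTwist p κ' (J' + 1)).toTopRep ψ) ≠ 0) :
    contOneCocycles.valueSubgroup ψ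
      ((κ.twistModPRepresentation (W.torsionGaloisModule (p : ℤ))
          (fun P : WeierstrassCurve.geomTorsion W (p : ℤ) => AddSubgroup.torsionBy.nsmul P) J).ker ⊓
        (κ'.twistModPRepresentation (W.torsionGaloisModule (p : ℤ))
          (fun P : WeierstrassCurve.geomTorsion W (p : ℤ) => AddSubgroup.torsionBy.nsmul P) (J' + 1)).ker)
      (fun _ hτ x => κ'.toTopRep_ρ_apply_eq_self_of_mem_ker (W.torsionGaloisModule (p : ℤ)) _ (J' + 1)
        (Subgroup.mem_inf.mp hτ).2 x) = ⊤ :=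
  valueSubgroup_eq_top_of_shiftH1_iterate_ne_zero W p κ' hirr hns hγ' J' ψ hψ _ _
    (fun ψ' hψ' => exists_mem_inf_ker_apply_ne_zero_of_ne_two W p κ κ' hp2 hirr hns J (J' + 1) ψ' hψ')

/-! ### The `p = 3` (class X10b = N2) instances, in the binder shape of `KatoMuTransferThree` -/

/-- **STEP 1 on class X10b = N2, `h`-side on the joint kernel** (`p = 3`, `E[3]` irreducible,
`ρ̄_{E,3}` NOT surjective; binder shape of `KatoMuTransferThree` / `CoreTheoremAOnClassX10b`).
[cite: Serre1972, §2.6] [cite: Sah1968, Prop. 2.7 (b)] -/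
theorem valueSubgroup_inf_eq_top_of_towerConst_ne_zero_three (hp3 : p = 3)
    (hirr : W.HasIrreducibleModPGaloisRep p) (hns : ¬ W.HasSurjectiveModNGaloisRep p)
    {γ : absoluteGaloisGroup ℚ} (hγ : κ.IsTopGenerator γ)
    (y : κ.twistTower (W.torsionGaloisModule (p : ℤ))
      (fun P : WeierstrassCurve.geomTorsion W (p : ℤ) => AddSubgroup.torsionBy.nsmul P))
    (hy : κ.towerConst (W.torsionGaloisModule (p : ℤ)) (fun P => AddSubgroup.torsionBy.nsmul P) y ≠ 0)
    (J J' : ℕ) (φ : contOneCocycles (W.modPTwist p κ (J + 1)).toTopRep)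
    (hφ : oneCocycleClass (W.modPTwist p κ (J + 1)).toTopRep φ = y.1 (J + 1)) :
    contOneCocycles.valueSubgroup φ
      ((κ.twistModPRepresentation (W.torsionGaloisModule (p : ℤ))
          (fun P : WeierstrassCurve.geomTorsion W (p : ℤ) => AddSubgroup.torsionBy.nsmul P) (J + 1)).ker ⊓
        (κ'.twistModPRepresentation (W.torsionGaloisModule (p : ℤ))
          (fun P : WeierstrassCurve.geomTorsion W (p : ℤ) => AddSubgroup.torsionBy.nsmul P) J').ker)
      (fun _ hτ x => κ.toTopRep_ρ_apply_eq_self_of_mem_ker (W.torsionGaloisModule (p : ℤ)) _ (J + 1)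
        (Subgroup.mem_inf.mp hτ).1 x) = ⊤ :=
  valueSubgroup_inf_eq_top_of_towerConst_ne_zero_of_ne_two W p κ κ' (by omega) hirr hns hγ y hy
    J J' φ hφ

/-- **STEP 1 on class X10b = N2, `h^*`-side on the joint kernel** (`p = 3`, `E[3]` irreducible,
`ρ̄_{E,3}` NOT surjective). [cite: Serre1972, §2.6] [cite: Sah1968, Prop. 2.7 (b)] -/
theorem valueSubgroup_inf_eq_top_of_shiftH1_iterate_ne_zero_three (hp3 : p = 3)
    (hirr : W.HasIrreducibleModPGaloisRep p) (hns : ¬ W.HasSurjectiveModNGaloisRep p)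
    {γ' : absoluteGaloisGroup ℚ} (hγ' : κ'.IsTopGenerator γ') (J J' : ℕ)
    (ψ : contOneCocycles (W.modPTwist p κ' (J' + 1)).toTopRep)
    (hψ : (κ'.shiftH1 (W.torsionGaloisModule (p : ℤ))
      (fun P : WeierstrassCurve.geomTorsion W (p : ℤ) => AddSubgroup.torsionBy.nsmul P) (J' + 1))^[J']
        (oneCocycleClass (W.modPTwist p κ' (J' + 1)).toTopRep ψ) ≠ 0) :
    contOneCocycles.valueSubgroup ψ
      ((κ.twistModPRepresentation (W.torsionGaloisModule (p : ℤ))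
          (fun P : WeierstrassCurve.geomTorsion W (p : ℤ) => AddSubgroup.torsionBy.nsmul P) J).ker ⊓
        (κ'.twistModPRepresentation (W.torsionGaloisModule (p : ℤ))
          (fun P : WeierstrassCurve.geomTorsion W (p : ℤ) => AddSubgroup.torsionBy.nsmul P) (J' + 1)).ker)
      (fun _ hτ x => κ'.toTopRep_ρ_apply_eq_self_of_mem_ker (W.torsionGaloisModule (p : ℤ)) _ (J' + 1)
        (Subgroup.mem_inf.mp hτ).2 x) = ⊤ :=
  valueSubgroup_inf_eq_top_of_shiftH1_iterate_ne_zero_of_ne_two W p κ κ' (by omega) hirr hns hγ'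
    J J' ψ hψ

end Summit.BirchSwinnertonDyer.BirchSwinnertonDyer.Rank1Residual.LevelE

end
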